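import Literature.Computability.AlgebraicComplexity.KoszulYoungCertificate
import Literature.Computability.AlgebraicComplexity.CoppersmithWinograd1982Crude
import HarnessLib

/-!
# Koszul flattenings with `dim A'` arbitrary: `rank ≤ C(a' - 1, p) · bR`, and the `a' = 4`, `p = 1` integer certificate

Topic `Literature/Computability/AlgebraicComplexity`; a trunk-independent TOOL extending
`KoszulFlatteningBorderRank.lean` (which proves the Koszul flattening bound only for projections onto
`A' = K^{2p+1}`, denominator `C(2p, p)`) and `KoszulYoungCertificate.lean` (integer certificates for
`p = 1`, `A' = K^3`).  Everything here is PROVED; nothing is specific to one tensor.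
HONEST FRAMING: the value is DECIDABLE VERDICTS / CERTIFICATES about explicit small tensors (the rows of
the certificate tables that import this file), not progress on the exponent of matrix multiplication.

## Content

* `koszulFlatteningGen q p Φ t` — the coordinate Koszul flattening
  `Λ^p K^q ⊗ (K^κ)^* → Λ^{p+1} K^q ⊗ K^μ` of `t ∈ K^ι ⊗ K^κ ⊗ K^μ` after `Φ : K^ι → K^q`, for EVERY
  `q` (for `q = 2p + 1` it is literally the tree's `koszulFlattening p Φ t`, `koszulFlatteningGen_two_mul_add_one`).
* `rank_wedgeBlockGen_le` — `rank (e ∧ · : Λ^p K^q → Λ^{p+1} K^q) ≤ C(q - 1, p)` (the rank-one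
  computation "the image of `a ⊗ b ⊗ c` is `a ∧ Λ^p A' ⊗ c`"), by the same kernel-vector count as the
  tree's `rank_wedgeBlock_le`: for `e_{j₀} ≠ 0` the `C(q-1, p-1)` vectors `e ∧ e_R` (`j₀ ∉ R`) are
  independent and in the kernel, and `C(q, p) - C(q-1, p-1) = C(q-1, p)`.
* `rank_koszulFlatteningGen_le_choose_mul_algBorderRank` — **Landsberg–Ottaviani 2013, Prop. 4.1.1 /
  2015, Thm. 2.1 in full generality** (`R̲(T) ≥ rank(T_A'^{∧p}) / C(dim A' - 1, p)`, CGLV 2022 §3 eq. (8),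
  Landsberg 2017 Prop. 2.4.2.1), for the algebraic border rank over `K[ε]`: linearity, the rank-one bound,
  and the algebraic semicontinuity lemma `rank_le_rank_map_of_perturbation` of
  `KoszulFlatteningBorderRank.lean`, verbatim with `2p + 1 ↦ q`.
* `KYGen.kyEntry4` / `KYGen.le_algBorderRank_of_kyCheck4Unit` — the `a' = 4`, `p = 1` flattening
  (a `6c × 4b` integer matrix: pairs of `Fin 4` numbered `0 ↦ {0,1}, 1 ↦ {0,2}, 2 ↦ {0,3}, 3 ↦ {1,2},
  4 ↦ {1,3}, 5 ↦ {2,3}`, singletons by their element) as a closed integer function on row/column codes,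
  identified with `koszulFlatteningGen 4 1` (`kyEntry4_eq`), so that a unit-pivot row certificate
  (`intTriCheckUnit`, `decide +kernel`) of `n > 3 (R - 1)` independent rows gives `R ≤ bR` over every
  field; `KYGen.le_algBorderRank_of_swap₁₃` transports a bound certified with the THIRD factor wedged and
  the second dualised.  This is the flattening that decides the three dimension-`4` rows `T4-304`,
  `T4-386`, `T4-424` of the tight-`[4]^3` census (rank `16 > 3 · 5` on the full `K^4`, where every
  restriction to a `K^3` has rank `≤ 10`), see `SmallTensorBorderRankTight4FourDimKoszul.lean`.

## References

* J. M. Landsberg, G. Ottaviani, *Equations for secant varieties of Veronese and other varieties*,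
  Ann. Mat. Pura Appl. (4) 192 (2013) 569–606, Prop. 4.1.1; *New lower bounds for the border rank of
  matrix multiplication*, Theory of Computing 11 (2015) 285–298, Thm. 2.1 and §2 (rank of
  `(a⊗b⊗c)_A^{∧p}` is `C(a-1, p)`). [LandsbergOttaviani2015]
* J. M. Landsberg, *Geometry and complexity theory*, CUP 2017, §2.4.2, (2.4.5)–(2.4.6) and
  Prop. 2.4.2.1. [LandsbergGCT2017]
* A. Conner, F. Gesmundo, J. M. Landsberg, E. Ventura, comput. complexity 31 (2022), §3 eq. (8)
  ("`R̲(T) ≥ rank(T_A^{∧p}) / C(dim A - 1, p)`"). [ConnerGesmundoLandsbergVentura2022]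
* M. Bläser, *Fast Matrix Multiplication*, Theory of Computing Library, Graduate Surveys 5 (2013),
  §5.1 (permutations of tensors), Def. 6.1. [Blaser2013]
-/

open scoped BigOperators Polynomial Matrix
open Matrix Polynomial

namespace Literature.Computability.AlgebraicComplexity

open Literature.LinearAlgebra.Matrix

universe u

/-! ## The rank-one step: `rank (e ∧ · : Λ^p K^q → Λ^{p+1} K^q) ≤ C(q - 1, p)` -/

section WedgeRankGen

variable {L : Type*} [Field L]

/-- The graded piece `Λ^p → Λ^{p+1}` of `e ∧ ·` on `L^q`, as a `PSub q (p+1) × PSub q p` matrix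
(the tree's `wedgeBlock p e` is the case `q = 2p + 1`). [folklore] -/
def wedgeBlockGen (q p : ℕ) (e : Fin q → L) : Matrix (PSub q (p + 1)) (PSub q p) L :=
  (wedgeMatrix e).submatrix (fun T => T.1) (fun S => S.1)

/-- **`rank (e ∧ · : Λ^p L^q → Λ^{p+1} L^q) ≤ C(q - 1, p)`**: for `e_{j₀} ≠ 0` the `C(q-1, p-1)`
vectors `e ∧ e_R`, `j₀ ∉ R`, `|R| = p - 1`, are independent (coefficient of `e_{R ∪ j₀}`) and lie in
the kernel (`e ∧ e = 0`), and `C(q, p) - C(q-1, p-1) = C(q-1, p)`.  This is the rank-one computation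
"the image of `(a ⊗ b ⊗ c)_A^{∧p}` is `a ∧ Λ^p A ⊗ c`, of dimension `C(dim A - 1, p)`".
[cite: LandsbergOttaviani2015, §2 (rank of (a⊗b⊗c)_A^{∧p})] [cite: LandsbergGCT2017, §2.4.2 (before Prop 2.4.2.1)] -/
theorem rank_wedgeBlockGen_le (q p : ℕ) (e : Fin q → L) :
    (wedgeBlockGen q p e).rank ≤ (q - 1).choose p := by
  classical
  by_cases he : e = 0
  · subst he
    have : wedgeBlockGen q p (0 : Fin q → L) = 0 := by
      ext T S; simp [wedgeBlockGen]
    rw [this, Matrix.rank_zero]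
    exact Nat.zero_le _
  obtain ⟨j0, hj0⟩ : ∃ j0, e j0 ≠ 0 := by
    by_contra h
    push Not at h
    exact he (funext h)
  obtain ⟨q', rfl⟩ : ∃ q', q = q' + 1 := ⟨q - 1, by have := j0.pos; omega⟩
  rw [Nat.add_sub_cancel]
  rcases Nat.eq_zero_or_pos p with rfl | hp
  · refine (Matrix.rank_le_card_width _).trans ?_
    rw [card_PSub]
    simp
  obtain ⟨p', rfl⟩ : ∃ p', p = p' + 1 := ⟨p - 1, by omega⟩
  -- the kernel vectors `e ∧ e_R`, `R = emb(R')`, `|R'| = p'`, `emb` omitting `j0`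
  have hj0R : ∀ R' : PSub q' p', j0 ∉ R'.1.map (Fin.succAboveEmb j0) := by
    intro R' h
    obtain ⟨y, _, hy⟩ := Finset.mem_map.1 h
    exact Fin.succAbove_ne j0 y hy
  have hcardR : ∀ R' : PSub q' p', (R'.1.map (Fin.succAboveEmb j0)).card = p' :=
    fun R' => by rw [Finset.card_map, R'.2]
  -- (i) they lie in the kernel
  have hker : ∀ R' : PSub q' p',
      wedgeBlockGen (q' + 1) (p' + 1) e *ᵥ
        (fun S : PSub (q' + 1) (p' + 1) =>
          wedgeMatrix e S.1 (R'.1.map (Fin.succAboveEmb j0))) = 0 := by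
    intro R'
    funext T
    rw [Matrix.mulVec, dotProduct, Pi.zero_apply]
    have full : ∑ S : Finset (Fin (q' + 1)),
        wedgeMatrix e T.1 S * wedgeMatrix e S (R'.1.map (Fin.succAboveEmb j0)) = 0 := by
      have := congrFun (congrFun (wedgeMatrix_mul_self e) T.1) (R'.1.map (Fin.succAboveEmb j0))
      rwa [Matrix.mul_apply] at this
    rw [← full]
    simp only [wedgeBlockGen, Matrix.submatrix_apply]
    rw [← Finset.sum_subtype
      (Finset.univ.filter fun S : Finset (Fin (q' + 1)) => S.card = p' + 1)
      (by simp) (fun S => wedgeMatrix e T.1 S * wedgeMatrix e S (R'.1.map (Fin.succAboveEmb j0)))]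
    apply Finset.sum_subset (Finset.filter_subset _ _)
    intro S _ hS
    rw [wedgeMatrix_of_not e (T := S), mul_zero]
    rintro ⟨-, hc⟩
    apply hS
    simp only [Finset.mem_filter, Finset.mem_univ, true_and]
    rw [hc, hcardR]
  -- (ii) they are linearly independent
  have hli : LinearIndependent L (fun (R' : PSub q' p')
      (S : PSub (q' + 1) (p' + 1)) =>
        wedgeMatrix e S.1 (R'.1.map (Fin.succAboveEmb j0))) := by
    rw [Fintype.linearIndependent_iff]
    intro g hg R₀
    have hS₀ : (insert j0 (R₀.1.map (Fin.succAboveEmb j0))).card = p' + 1 := by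
      rw [Finset.card_insert_of_notMem (hj0R R₀), hcardR]
    have h := congrFun hg ⟨insert j0 (R₀.1.map (Fin.succAboveEmb j0)), hS₀⟩
    rw [Finset.sum_apply, Pi.zero_apply, Fintype.sum_eq_single R₀] at h
    · simp only [Pi.smul_apply, smul_eq_mul] at h
      rw [wedgeMatrix_insert e (hj0R R₀)] at h
      rcases mul_eq_zero.1 h with h | h
      · exact h
      · exfalso
        rcases mul_eq_zero.1 h with h | h
        · have hs := koszulSign_mul_self (R₀.1.map (Fin.succAboveEmb j0)) j0
          apply_fun (fun z : ℤ => (z : L)) at hs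
          push_cast at hs
          rw [h, zero_mul] at hs
          exact zero_ne_one hs
        · exact hj0 h
    · intro R hR
      simp only [Pi.smul_apply, smul_eq_mul]
      rw [wedgeMatrix_of_not, mul_zero]
      rintro ⟨hsub, -⟩
      apply hR
      have h1 : R.1.map (Fin.succAboveEmb j0) ⊆ R₀.1.map (Fin.succAboveEmb j0) := by
        intro x hx
        rcases Finset.mem_insert.1 (hsub hx) with rfl | h
        · exact absurd hx (hj0R R)
        · exact h
      have h2 : R.1.map (Fin.succAboveEmb j0) = R₀.1.map (Fin.succAboveEmb j0) :=
        Finset.eq_of_subset_of_card_le h1 (by rw [hcardR, hcardR])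
      exact Subtype.ext (Finset.map_injective (Fin.succAboveEmb j0) h2)
  -- (iii) so the kernel has dimension ≥ C(q', p')
  have hker_dim : Fintype.card (PSub q' p') ≤
      Module.finrank L (LinearMap.ker (wedgeBlockGen (q' + 1) (p' + 1) e).mulVecLin) := by
    have hmem : ∀ R' : PSub q' p',
        (fun S : PSub (q' + 1) (p' + 1) =>
          wedgeMatrix e S.1 (R'.1.map (Fin.succAboveEmb j0))) ∈
          LinearMap.ker (wedgeBlockGen (q' + 1) (p' + 1) e).mulVecLin := fun R' => by
      rw [LinearMap.mem_ker, Matrix.mulVecLin_apply, hker]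
    have hli' := LinearIndependent.of_comp
      (LinearMap.ker (wedgeBlockGen (q' + 1) (p' + 1) e).mulVecLin).subtype
      (by exact hli : LinearIndependent L
        ((LinearMap.ker (wedgeBlockGen (q' + 1) (p' + 1) e).mulVecLin).subtype ∘
          fun R' => ⟨_, hmem R'⟩))
    exact hli'.fintype_card_le_finrank
  -- (iv) rank-nullity
  have hrn := LinearMap.finrank_range_add_finrank_ker (wedgeBlockGen (q' + 1) (p' + 1) e).mulVecLin
  rw [Module.finrank_fintype_fun_eq_card, card_PSub] at hrn
  rw [card_PSub] at hker_dim
  have hrank : (wedgeBlockGen (q' + 1) (p' + 1) e).rank =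
      Module.finrank L (LinearMap.range (wedgeBlockGen (q' + 1) (p' + 1) e).mulVecLin) := rfl
  have hpascal : (q' + 1).choose (p' + 1) = q'.choose p' + q'.choose (p' + 1) := by
    rw [Nat.choose_succ_succ]
  omega

end WedgeRankGen

/-! ## The Koszul flattening after a projection onto `K^q`, `q` arbitrary -/

section KoszulGen

variable {K : Type*} [CommRing K]

/-- The **Koszul flattening** of `t ∈ K^ι ⊗ K^κ ⊗ K^μ` after a linear map `Φ : K^ι → A' = K^q` on the
first factor, for ANY `q` (Landsberg–Ottaviani; GCT (2.4.5)–(2.4.6)): the matrix of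
`((Φ ⊗ 1 ⊗ 1) t)_{A'}^{∧p} : Λ^p A' ⊗ (K^κ)^* → Λ^{p+1} A' ⊗ K^μ`, rows `(T, c)` with `|T| = p + 1`,
columns `(S, b)` with `|S| = p`, entry `(Φ(t(·, b, c)) ∧ e_S)_T`.  For `q = 2p + 1` this is the tree's
`koszulFlattening p Φ t`. [cite: LandsbergGCT2017, §2.4.2 (2.4.5)-(2.4.6)] [cite: LandsbergOttaviani2015, §2 (T_A^{∧p})] -/
def koszulFlatteningGen (q p : ℕ) {ι κ μ : Type*} (Φ : (ι → K) →ₗ[K] (Fin q → K))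
    (t : ι → κ → μ → K) : Matrix (PSub q (p + 1) × μ) (PSub q p × κ) K :=
  Matrix.of fun r c => wedgeMatrix (Φ fun a => t a c.2 r.2) r.1.1 c.1.1

/-- Unfolding lemma for `koszulFlatteningGen`. [cite: LandsbergGCT2017, §2.4.2 (2.4.6)] -/
theorem koszulFlatteningGen_apply (q p : ℕ) {ι κ μ : Type*}
    (Φ : (ι → K) →ₗ[K] (Fin q → K)) (t : ι → κ → μ → K)
    (r : PSub q (p + 1) × μ) (c : PSub q p × κ) :
    koszulFlatteningGen q p Φ t r c = wedgeMatrix (Φ fun a => t a c.2 r.2) r.1.1 c.1.1 := rfl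

/-- For `q = 2p + 1` the general flattening is the tree's `koszulFlattening`. [cite: LandsbergGCT2017, §2.4.2 (2.4.6)] -/
theorem koszulFlatteningGen_two_mul_add_one (p : ℕ) {ι κ μ : Type*}
    (Φ : (ι → K) →ₗ[K] (Fin (2 * p + 1) → K)) (t : ι → κ → μ → K) :
    koszulFlatteningGen (2 * p + 1) p Φ t = koszulFlattening p Φ t := rfl

/-- `t ↦ K_Φ(t)` is additive. [cite: LandsbergGCT2017, §2.4.2 ("By linearity of the map T ↦ T_A^{∧p}")] -/
theorem koszulFlatteningGen_add (q p : ℕ) {ι κ μ : Type*}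
    (Φ : (ι → K) →ₗ[K] (Fin q → K)) (t t' : ι → κ → μ → K) :
    koszulFlatteningGen q p Φ (t + t') = koszulFlatteningGen q p Φ t + koszulFlatteningGen q p Φ t' := by
  ext r c
  simp only [koszulFlatteningGen_apply, Matrix.add_apply]
  rw [← Matrix.add_apply (wedgeMatrix _) (wedgeMatrix _), ← wedgeMatrix_add, ← map_add]
  rfl

/-- `K_Φ(0) = 0`. [cite: LandsbergGCT2017, §2.4.2 ("By linearity of the map T ↦ T_A^{∧p}")] -/
@[simp] theorem koszulFlatteningGen_zero (q p : ℕ) {ι κ μ : Type*}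
    (Φ : (ι → K) →ₗ[K] (Fin q → K)) :
    koszulFlatteningGen q p Φ (0 : ι → κ → μ → K) = 0 := by
  ext r c
  simp only [koszulFlatteningGen_apply, Matrix.zero_apply]
  rw [show (fun a : ι => (0 : ι → κ → μ → K) a c.2 r.2) = 0 from rfl, map_zero, wedgeMatrix_zero]
  rfl

/-- `t ↦ K_Φ(t)` commutes with finite sums. [cite: LandsbergGCT2017, §2.4.2 ("By linearity of the map T ↦ T_A^{∧p}")] -/
theorem koszulFlatteningGen_sum (q p : ℕ) {ι κ μ σ : Type*}
    (Φ : (ι → K) →ₗ[K] (Fin q → K)) (s : Finset σ) (t : σ → ι → κ → μ → K) :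
    koszulFlatteningGen q p Φ (∑ i ∈ s, t i) = ∑ i ∈ s, koszulFlatteningGen q p Φ (t i) := by
  classical
  induction s using Finset.induction_on with
  | empty => simp
  | insert a s ha ih =>
    rw [Finset.sum_insert ha, Finset.sum_insert ha, koszulFlatteningGen_add, ih]

/-- `t ↦ K_Φ(t)` is homogeneous: `K_Φ(x • t) = x • K_Φ(t)`. [folklore] -/
theorem koszulFlatteningGen_smul (q p : ℕ) {ι κ μ : Type*} (Φ : (ι → K) →ₗ[K] (Fin q → K))
    (x : K) (t : ι → κ → μ → K) :
    koszulFlatteningGen q p Φ (x • t) = x • koszulFlatteningGen q p Φ t := by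
  ext r c
  simp only [koszulFlatteningGen_apply, Matrix.smul_apply, smul_eq_mul]
  rw [show (fun a => (x • t) a c.2 r.2) = x • fun a => t a c.2 r.2 from rfl, map_smul,
    wedgeMatrix_smul, Matrix.smul_apply, smul_eq_mul]

/-- **Base change**: for `Φ = M.mulVecLin`, applying a ring homomorphism `f` entrywise commutes with
the flattening (`Φ ↦ M.map f`, `t ↦ f ∘ t`). [folklore] -/
theorem koszulFlatteningGen_mulVecLin_map (q p : ℕ) {ι κ μ : Type*} [Fintype ι] {S : Type*}
    [CommRing S] (f : K →+* S) (M : Matrix (Fin q) ι K) (t : ι → κ → μ → K) :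
    (koszulFlatteningGen q p M.mulVecLin t).map f =
      koszulFlatteningGen q p (M.map f).mulVecLin (fun a b c => f (t a b c)) := by
  ext r c
  simp only [Matrix.map_apply, koszulFlatteningGen_apply, wedgeMatrix_apply, Matrix.mulVecLin_apply,
    map_sum]
  refine Finset.sum_congr rfl fun j _ => ?_
  split_ifs
  · rw [map_mul, map_intCast, RingHom.map_mulVec]
    rfl
  · rw [map_zero]

end KoszulGen

/-! ## `rank K_Φ(t) ≤ C(q-1, p) · R(t)` over a field -/

section KoszulRankGen

variable {L : Type*} [Field L]

/-- The flattening of a triad factors through the graded piece of `Φ(w) ∧ ·`: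
`K_Φ(w ⊗ u ⊗ v) = D_v · (Φw ∧ ·) · D_u`. [cite: LandsbergGCT2017, §2.4.2 (rank of T_A^{∧p} for T = a⊗b⊗c)] -/
theorem koszulFlatteningGen_triad (q p : ℕ) {ι κ μ : Type*}
    (Φ : (ι → L) →ₗ[L] (Fin q → L)) (w : ι → L) (u : κ → L) (v : μ → L) :
    koszulFlatteningGen q p Φ (triad w u v) =
      (Matrix.of fun (r : PSub q (p + 1) × μ) (T' : PSub q (p + 1)) =>
          if r.1 = T' then v r.2 else 0) *
        wedgeBlockGen q p (Φ w) *
        (Matrix.of fun (S' : PSub q p) (c : PSub q p × κ) =>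
          if S' = c.1 then u c.2 else 0) := by
  ext r c
  rw [Matrix.mul_apply]
  simp only [Matrix.mul_apply, Matrix.of_apply, ite_mul, zero_mul, Finset.sum_ite_eq,
    Finset.mem_univ, if_true, mul_ite, mul_zero]
  rw [Finset.sum_ite_eq' Finset.univ c.1, if_pos (Finset.mem_univ _)]
  rw [koszulFlatteningGen_apply]
  have : (fun a => triad w u v a c.2 r.2) = (u c.2 * v r.2) • w := by
    funext a; simp [triad, mul_comm, mul_left_comm]
  rw [this, map_smul, wedgeMatrix_smul]
  simp only [wedgeBlockGen, Matrix.submatrix_apply, Matrix.smul_apply, smul_eq_mul]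
  ring

/-- `rank K_Φ(w ⊗ u ⊗ v) ≤ C(q-1, p)`. [cite: LandsbergOttaviani2015, §2 ("rank((a⊗b⊗c)_A^{∧p}) = binom(a−1,p)")] -/
theorem rank_koszulFlatteningGen_triad_le (q p : ℕ) {ι κ μ : Type*} [Fintype κ]
    (Φ : (ι → L) →ₗ[L] (Fin q → L)) (w : ι → L) (u : κ → L) (v : μ → L) :
    (koszulFlatteningGen q p Φ (triad w u v)).rank ≤ (q - 1).choose p := by
  rw [koszulFlatteningGen_triad]
  exact ((Matrix.rank_mul_le_left _ _).trans (Matrix.rank_mul_le_right _ _)).trans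
    (rank_wedgeBlockGen_le q p (Φ w))

/-- `rank K_Φ(∑_{i<r} w_i ⊗ u_i ⊗ v_i) ≤ C(q-1, p) · r`. [cite: LandsbergOttaviani2015, Thm 2.1 (proof)] -/
theorem rank_koszulFlatteningGen_sum_triad_le (q p : ℕ) {ι κ μ : Type*} [Fintype κ]
    (Φ : (ι → L) →ₗ[L] (Fin q → L)) {r : ℕ} (w : Fin r → ι → L)
    (u : Fin r → κ → L) (v : Fin r → μ → L) :
    (koszulFlatteningGen q p Φ (∑ i, triad (w i) (u i) (v i))).rank ≤ (q - 1).choose p * r := by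
  rw [koszulFlatteningGen_sum]
  refine (matrix_rank_sum_le _ _).trans ?_
  calc ∑ i : Fin r, (koszulFlatteningGen q p Φ (triad (w i) (u i) (v i))).rank
      ≤ ∑ _i : Fin r, (q - 1).choose p :=
        Finset.sum_le_sum fun i _ => rank_koszulFlatteningGen_triad_le q p Φ (w i) (u i) (v i)
    _ = (q - 1).choose p * r := by simp [mul_comm]

/-- **`rank K_Φ(t) ≤ C(q-1, p) · R(t)`** (rank version of LO2015 Thm. 2.1 / GCT Prop. 2.4.2.1, any
`dim A' = q`). [cite: LandsbergOttaviani2015, Thm 2.1 (proof)] [cite: LandsbergGCT2017, Prop 2.4.2.1] -/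
theorem rank_koszulFlatteningGen_le_choose_mul_tensorRank (q p : ℕ) {ι κ μ : Type*} [Fintype ι]
    [Fintype κ] [Fintype μ] (Φ : (ι → L) →ₗ[L] (Fin q → L)) (t : ι → κ → μ → L) :
    (koszulFlatteningGen q p Φ t).rank ≤ (q - 1).choose p * tensorRank t := by
  obtain ⟨w, u, v, ht⟩ := exists_triad_decomposition_tensorRank t
  have h := rank_koszulFlatteningGen_sum_triad_le q p Φ w u v
  rwa [← ht] at h

end KoszulRankGen

/-! ## The border rank bound `rank K_M(t) ≤ C(q-1, p) · bR(t)` -/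

section BorderRankGen

variable {K : Type u} [Field K] {ι κ μ : Type} [Fintype ι] [Fintype κ] [Fintype μ]

/-- **The Koszul flattening lower bound for border rank, any `dim A'`** (Landsberg–Ottaviani 2013,
Prop. 4.1.1 / 2015, Thm. 2.1; CGLV 2022, §3, eq. (8); GCT Prop. 2.4.2.1): for every tensor
`t ∈ K^ι ⊗ K^κ ⊗ K^μ` over a field, every `p`, `q` and every `M : K^ι → K^q`,
`rank K_M(t) ≤ C(q-1, p) · R̲(t)`, for the algebraic border rank over `K[ε]` — the proof of
`rank_koszulFlattening_le_choose_mul_algBorderRank` with `2p + 1 ↦ q`.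
[cite: ConnerGesmundoLandsbergVentura2022, §3 eq. (8)] [cite: LandsbergOttaviani2015, Thm 2.1] -/
theorem rank_koszulFlatteningGen_le_choose_mul_algBorderRank [DecidableEq ι] [DecidableEq κ]
    [DecidableEq μ] (q p : ℕ) (M : Matrix (Fin q) ι K) (t : ι → κ → μ → K) :
    (koszulFlatteningGen q p M.mulVecLin t).rank ≤ (q - 1).choose p * algBorderRank t := by
  classical
  obtain ⟨h, hh⟩ : ∃ h, approxRank h t = algBorderRank t := by
    obtain ⟨h, hh⟩ := Nat.sInf_mem (Set.range_nonempty fun h : ℕ => approxRank h t)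
    exact ⟨h, hh⟩
  obtain ⟨u, v, w, huvw⟩ := Nat.sInf_mem (exists_isApproxDecomposition h t)
  set r := approxRank h t with hr
  set T : ι → κ → μ → K[X] := ∑ ρ, triad (u ρ) (v ρ) (w ρ) with hTdef
  have hT : ∀ a b c, ∀ j ≤ h, (T a b c).coeff j = if j = h then t a b c else 0 := by
    intro a b c j hj
    rw [← huvw a b c j hj, hTdef]
    simp only [Finset.sum_apply, triad_apply]
  have hdvd : ∀ a b c, X ^ (h + 1) ∣ T a b c - C (t a b c) * X ^ h := by
    intro a b c
    rw [X_pow_dvd_iff]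
    intro d hd
    rw [coeff_sub, coeff_C_mul_X_pow, hT a b c d (by omega)]
    split_ifs <;> simp
  choose T' hT' using hdvd
  have hTe : T = (X : K[X]) ^ h • ((fun a b c => C (t a b c)) + (X : K[X]) • T') := by
    funext a b c
    simp only [Pi.smul_apply, Pi.add_apply, smul_eq_mul]
    linear_combination hT' a b c
  have hKF : koszulFlatteningGen q p (M.map (C : K →+* K[X])).mulVecLin T =
      (X : K[X]) ^ h • ((koszulFlatteningGen q p M.mulVecLin t).map (C : K →+* K[X]) +
        (X : K[X]) • koszulFlatteningGen q p (M.map (C : K →+* K[X])).mulVecLin T') := by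
    rw [hTe, koszulFlatteningGen_smul, koszulFlatteningGen_add, koszulFlatteningGen_smul,
      koszulFlatteningGen_mulVecLin_map]
  have hN : ∀ i j, koszulFlatteningGen q p (M.map (C : K →+* K[X])).mulVecLin T i j =
      (C (koszulFlatteningGen q p M.mulVecLin t i j) +
        X * koszulFlatteningGen q p (M.map (C : K →+* K[X])).mulVecLin T' i j) * X ^ h := by
    intro i j
    rw [hKF]
    simp only [Matrix.smul_apply, Matrix.add_apply, Matrix.map_apply, smul_eq_mul]
    ring
  let L := FractionRing K[X]
  have key := rank_le_rank_map_of_perturbation (L := L) (koszulFlatteningGen q p M.mulVecLin t)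
    (koszulFlatteningGen q p (M.map (C : K →+* K[X])).mulVecLin T')
    (koszulFlatteningGen q p (M.map (C : K →+* K[X])).mulVecLin T) h hN
  have hmapT : (fun a b c => algebraMap K[X] L (T a b c)) =
      ∑ ρ, triad (fun a => algebraMap K[X] L (u ρ a)) (fun b => algebraMap K[X] L (v ρ b))
        (fun c => algebraMap K[X] L (w ρ c)) := by
    funext a b c
    simp only [hTdef, Finset.sum_apply, triad_apply, map_sum, map_mul]
  have hbound : ((koszulFlatteningGen q p (M.map (C : K →+* K[X])).mulVecLin T).map
      (algebraMap K[X] L)).rank ≤ (q - 1).choose p * r := by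
    rw [koszulFlatteningGen_mulVecLin_map, hmapT]
    exact rank_koszulFlatteningGen_sum_triad_le q p _ _ _ _
  rw [← hh]
  exact key.trans hbound

/-- The bound in the form in which it is used (`R̲(t) ≥ ⌈rank / C(q-1, p)⌉`): if
`rank K_M(t) > C(q-1, p) · (R - 1)` then `R ≤ R̲(t)`. [cite: ConnerGesmundoLandsbergVentura2022, §3 eq. (8)] -/
theorem le_algBorderRank_of_lt_rank_koszulFlatteningGen [DecidableEq ι] [DecidableEq κ]
    [DecidableEq μ] (q p : ℕ) (M : Matrix (Fin q) ι K) (t : ι → κ → μ → K) {R : ℕ}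
    (hR : (q - 1).choose p * (R - 1) < (koszulFlatteningGen q p M.mulVecLin t).rank) :
    R ≤ algBorderRank t := by
  have h := rank_koszulFlatteningGen_le_choose_mul_algBorderRank q p M t
  have := Nat.lt_of_mul_lt_mul_left (hR.trans_le h)
  omega

end BorderRankGen

/-! ## The `dim A' = 4`, `p = 1` flattening on codes, and its integer certificate -/

namespace KYGen

open KYCert

/-- The `4 × a` integer matrix of a list of rows: the map `Φ : K^a → A' = K^4`, in coordinates.
[cite: ConnerGesmundoLandsbergVentura2022, §3] -/
def mat4 (a : ℕ) (M : List (List ℤ)) : Matrix (Fin 4) (Fin a) ℤ := Matrix.of fun x i => mget M x i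

/-- The pairs of `Fin 4` by number: `0 ↦ {0,1}, 1 ↦ {0,2}, 2 ↦ {0,3}, 3 ↦ {1,2}, 4 ↦ {1,3}, 5 ↦ {2,3}`.
[folklore] -/
def pairOf4 (i : Fin 6) : PSub 4 2 :=
  ![⟨{0, 1}, by decide⟩, ⟨{0, 2}, by decide⟩, ⟨{0, 3}, by decide⟩, ⟨{1, 2}, by decide⟩,
    ⟨{1, 3}, by decide⟩, ⟨{2, 3}, by decide⟩] i

/-- The singletons of `Fin 4` by their element. [folklore] -/
def singOf4 (i : Fin 4) : PSub 4 1 :=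
  ![⟨{0}, by decide⟩, ⟨{1}, by decide⟩, ⟨{2}, by decide⟩, ⟨{3}, by decide⟩] i

/-- The number of the pair `{lo, hi}`, `lo < hi < 4`. [folklore] -/
def pairCode4 (lo hi : ℕ) : ℕ := if lo = 0 then hi - 1 else if lo = 1 then hi + 1 else 5

/-- The signed incidence `ε` of `e_x ∧ e_{s} = ε e_P` on codes (`P` a pair number, `s`, `x < 4`):
`ε({s}, x) = -1` if `s < x`, `+1` if `x < s`, and `0` unless `P = {s, x}`. [folklore] -/
def incZ4 (P s x : ℕ) : ℤ :=
  if s < x ∧ x < 4 ∧ P = pairCode4 s x then -1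
  else if x < s ∧ s < 4 ∧ P = pairCode4 x s then 1 else 0

/-- The incidence table is the signed incidence of the wedge. [folklore] -/
theorem incZ4_eq : ∀ (P : Fin 6) (s x : Fin 4), incZ4 P s x =
    (if x ∉ (singOf4 s).1 ∧ (pairOf4 P).1 = insert x (singOf4 s).1 then koszulSign (singOf4 s).1 x
     else 0) := by
  decide

/-- Row decoder: code `r ↦ (pair no. r / c, third index r % c)`. [folklore] -/
def rowDec4 (c : ℕ) [NeZero c] (r : ℕ) : PSub 4 2 × Fin c := (pairOf4 (finCode 6 (r / c)), finCode c r)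

/-- Column decoder: code `q ↦ (singleton no. q / b, second index q % b)`. [folklore] -/
def colDec4 (b : ℕ) [NeZero b] (q : ℕ) : PSub 4 1 × Fin b := (singOf4 (finCode 4 (q / b)), finCode b q)

/-- Entry `(r, q)` of the integer `dim A' = 4`, `p = 1` Koszul flattening on codes:
`∑_{x<4} ε(pair r/c, singleton q/b, x) · ∑_{i<a} M[x][i] · T i (q % b) (r % c)`.
[cite: LandsbergOttaviani2015, Thm. 2.1] [cite: LandsbergGCT2017, §2.4.2 (2.4.6)] -/
def kyEntry4 (a b c : ℕ) [NeZero a] [NeZero b] [NeZero c] (M : List (List ℤ))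
    (T : Fin a → Fin b → Fin c → ℤ) (r q : ℕ) : ℤ :=
  lsum 4 fun x => incZ4 (r / c % 6) (q / b % 4) x *
    lsum a fun i => mget M x i * T (finCode a i) (finCode b q) (finCode c r)

/-- The code matrix IS `koszulFlatteningGen 4 1 (mat4 a M).mulVecLin T` (over `ℤ`), read through the
decoders. [cite: LandsbergGCT2017, §2.4.2 (2.4.6)] -/
theorem kyEntry4_eq (a b c : ℕ) [NeZero a] [NeZero b] [NeZero c] (M : List (List ℤ))
    (T : Fin a → Fin b → Fin c → ℤ) (r q : ℕ) :
    kyEntry4 a b c M T r q =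
      koszulFlatteningGen 4 1 (mat4 a M).mulVecLin T (rowDec4 c r) (colDec4 b q) := by
  have hf : ∀ i : Fin a, finCode a (i : ℕ) = i := fun i => Fin.ext (Nat.mod_eq_of_lt i.isLt)
  have hinc : ∀ x : Fin 4, incZ4 (r / c % 6) (q / b % 4) x =
      (if x ∉ (singOf4 (finCode 4 (q / b))).1 ∧
          (pairOf4 (finCode 6 (r / c))).1 = insert x (singOf4 (finCode 4 (q / b))).1
        then koszulSign (singOf4 (finCode 4 (q / b))).1 x else 0) :=
    fun x => incZ4_eq (finCode 6 (r / c)) (finCode 4 (q / b)) x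
  rw [koszulFlatteningGen_apply, wedgeMatrix_apply]
  simp only [kyEntry4, lsum_eq, rowDec4, colDec4, Matrix.mulVecLin_apply, Matrix.mulVec, dotProduct,
    mat4, Matrix.of_apply, hf, Int.cast_id, hinc]
  refine Finset.sum_congr rfl fun x _ => ?_
  split_ifs <;> simp

/-- **`dim A' = 4` Koszul–Young certificate ⇒ `R ≤ bR`**, characteristic zero: if `n` rows of the
integer `p = 1` Koszul flattening of `T` after the `4 × a` matrix `M` are certified independent and
`3 (R - 1) < n`, then `R ≤ bR(T ⊗ K)` (`rank ≤ C(3,1) · bR`).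
[cite: LandsbergOttaviani2015, Thm. 2.1] [cite: ConnerGesmundoLandsbergVentura2022, §3 eq. (8)] -/
theorem le_algBorderRank_of_kyCheck4 (K : Type u) [Field K] [CharZero K] {a b c : ℕ} [NeZero a]
    [NeZero b] [NeZero c] (M : List (List ℤ)) (T : Fin a → Fin b → Fin c → ℤ) {n R : ℕ}
    {rows : List (List (ℕ × ℤ))} {piv : List ℕ}
    (h : intTriCheck n (kyEntry4 a b c M T) rows piv = true) (hR : 3 * (R - 1) < n) :
    R ≤ algBorderRank (fun i j l => (T i j l : K)) := by
  have e : kyEntry4 a b c M T =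
      fun r q => koszulFlatteningGen 4 1 (mat4 a M).mulVecLin T (rowDec4 c r) (colDec4 b q) :=
    funext fun r => funext fun q => kyEntry4_eq a b c M T r q
  rw [e] at h
  have hr := le_rank_of_intTriCheck (F := K) (koszulFlatteningGen 4 1 (mat4 a M).mulVecLin T)
    (rowDec4 c) (colDec4 b) h
  have hm : (koszulFlatteningGen 4 1 (mat4 a M).mulVecLin T).map (Int.cast : ℤ → K) =
      koszulFlatteningGen 4 1 ((mat4 a M).map (Int.cast : ℤ → K)).mulVecLin
        (fun i j l => (T i j l : K)) :=
    koszulFlatteningGen_mulVecLin_map 4 1 (Int.castRingHom K) (mat4 a M) T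
  rw [hm] at hr
  refine le_algBorderRank_of_lt_rank_koszulFlatteningGen 4 1 ((mat4 a M).map (Int.cast : ℤ → K)) _ ?_
  have h3 : (4 - 1).choose 1 = 3 := by decide
  rw [h3]
  omega

/-- **`dim A' = 4` Koszul–Young certificate ⇒ `R ≤ bR`**, every field: the same with UNIT pivots
(`intTriCheckUnit`). [cite: LandsbergOttaviani2015, Thm. 2.1] [cite: ConnerGesmundoLandsbergVentura2022, §3 eq. (8)] -/
theorem le_algBorderRank_of_kyCheck4Unit (K : Type u) [Field K] {a b c : ℕ} [NeZero a]
    [NeZero b] [NeZero c] (M : List (List ℤ)) (T : Fin a → Fin b → Fin c → ℤ) {n R : ℕ}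
    {rows : List (List (ℕ × ℤ))} {piv : List ℕ}
    (h : intTriCheckUnit n (kyEntry4 a b c M T) rows piv = true) (hR : 3 * (R - 1) < n) :
    R ≤ algBorderRank (fun i j l => (T i j l : K)) := by
  have e : kyEntry4 a b c M T =
      fun r q => koszulFlatteningGen 4 1 (mat4 a M).mulVecLin T (rowDec4 c r) (colDec4 b q) :=
    funext fun r => funext fun q => kyEntry4_eq a b c M T r q
  rw [e] at h
  have hr := le_rank_of_intTriCheckUnit (F := K) (koszulFlatteningGen 4 1 (mat4 a M).mulVecLin T)
    (rowDec4 c) (colDec4 b) h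
  have hm : (koszulFlatteningGen 4 1 (mat4 a M).mulVecLin T).map (Int.cast : ℤ → K) =
      koszulFlatteningGen 4 1 ((mat4 a M).map (Int.cast : ℤ → K)).mulVecLin
        (fun i j l => (T i j l : K)) :=
    koszulFlatteningGen_mulVecLin_map 4 1 (Int.castRingHom K) (mat4 a M) T
  rw [hm] at hr
  refine le_algBorderRank_of_lt_rank_koszulFlatteningGen 4 1 ((mat4 a M).map (Int.cast : ℤ → K)) _ ?_
  have h3 : (4 - 1).choose 1 = 3 := by decide
  rw [h3]
  omega

/-- A bound certified for `(l, j, i) ↦ T i j l` (third factor wedged, second dualised) is a bound for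
`T` (`algBorderRank_swap₂₃` and `algBorderRank_rotate`). [cite: Blaser2013, §5.1 (permutation of tensors)] -/
theorem le_algBorderRank_of_swap₁₃ (K : Type u) [Field K] {a b c : ℕ}
    (T : Fin a → Fin b → Fin c → ℤ) {R : ℕ} (h : R ≤ algBorderRank (fun l j i => (T i j l : K))) :
    R ≤ algBorderRank (fun i j l => (T i j l : K)) := by
  refine le_algBorderRank_of_rotate₂ K T ?_
  rw [← algBorderRank_swap₂₃ (fun l i j => (T i j l : K))]
  exact h

end KYGen

end Literature.Computability.AlgebraicComplexity
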